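import Summits.QuantumFields.BalabanUV.Beta.GAN24.ExponentialChartBasePolarisation

/-!
# `BalabanUV.Beta.GAN24.ExponentialChartBaseHessianTransport` — binder row G-an2-4 ∕ (CONV-C), route R7 «TWO CURRENCIES», PART 276: TRANSPORT OF THE INFINITE-VOLUME LIMIT DATA
# ALONG THE LINEAR STRUCTURE OF THE ONE-LOOP HESSIAN AT `U₀`.  PARTs 271 ∕ 274 ∕ 275 compare limit kernels that a consumer ALREADY holds for each family; this file moves ONE
# witness to the others, so a consumer who obtained PART 269's END for `(A, B)` (or leaf-01's `N = 2` END) need not re-invoke an END for the related families: at a fixed level `k`,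
# **an `IsInfiniteVolumeLimit` witness `Π` for `(A, B)` IS a witness for `(B, A)`** (`hessianAt_symm` volume by volume); **witnesses ADD and SCALE with the directions**
# (`Π₁ + Π₂` for `(A₁ + A₂, B)`, `c • Π` for `(cA, B)`, and in `B`); **the diagonal witness for `(A, A)` IS a witness for leaf-01's `N = 2` family of `A` and conversely — with NO
# hypothesis** (`hessianAt_diag_shift`); and **`2Π + Π⁽²⁾_A + Π⁽²⁾_B` is a witness for the `N = 2` family of `A + B`** (PART 275).  All but the diagonal under the invertibility of
# `Δ_a + (Δ^{U₀} − Δ^1)` and `c_k(U₀)` at every volume (PART 271 §0 on the disc) (unit b2b-balaban-gan24-p3, gen 67; v1; generator `HOME/b2b-balaban-gan24-p3/gen67/records/gen/gen276.py`)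

NOT IN PRINT; OUR PROOF ([folklore] bookkeeping BY NAME over PART 270 (`hessianAt_symm ∕ _add_left ∕ _smul_left ∕ _add_right ∕ _smul_right`), PART 274 (`hessianAt_diag_shift`), PART 275
(`hessianAt_add_self_eq_polarisation`); Mathlib's `Filter.Tendsto.congr ∕ add ∕ const_mul`, `Matrix.add_apply ∕ smul_apply ∕ sub_apply`, `Complex.add_re ∕ sub_re ∕ re_ofReal_mul`;
Literature `Beta.OneLoop.IsInfiniteVolumeLimit` unfolded; [Balaban1987RG1] (1.20)–(1.22) p. 264 LOCATE the shapes; nothing printed is a hypothesis).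
HONEST FRAMING (cell contract, verbatim): «discharging `BetaPertH` makes Bałaban's UV stability UNCONDITIONAL — a real constructive-QFT result; it is NOT the
continuum limit and NOT the Clay problem.»  HONEST DEPENDENCY (verbatim): «continuum YM on T⁴ ⇐ BetaPertH ∧ nine spine estimates (0/9 proved); BetaPertH ⇐
(D1) ∧ (D4) ∧ CAP+tail; G-an2-4 gates asym, D1 and NE2/3/4.»

WHAT THIS FILE PROVES (0 sorry, 0 `def`; even cubic volumes `2(t+1)`, level `k`, REAL `A₀` and directions; `h0 ∕ hc0 : ∀ t` displayed except in §2):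
* §1 **`isInfiniteVolumeLimit_hessianAt_swap`**, **`isInfiniteVolumeLimit_hessianAt_add_left`**, **`isInfiniteVolumeLimit_hessianAt_smul_left`**, `_add_right`, `_smul_right`.
* §2 **`isInfiniteVolumeLimit_hessianAt_diag_iff`** (NO hypothesis).
* §3 **`isInfiniteVolumeLimit_lineAt_add_of_hessianAt`** (the `N = 2` witness of `A + B` from `Π(A, B)`, `Π⁽²⁾_A`, `Π⁽²⁾_B`).
WHAT IT DOES NOT DO: transport of (UD) ∕ (SR) ∕ the rate constants (they follow the same linear algebra with `|c|`-scaled ∕ summed constants — on ask); colour; Bałaban's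
`−∂P∂*` ∕ `aQ(U)*Q(U)` parts.  SUPPLIER work; NEVER «G-an2-4 closed»; NOT (CONV-C), NOT D1, NOT `BetaPertH`, NOT continuum, NOT Clay.  Records: `HOME/b2b-balaban-gan24-p3/gen67/README.md`.
-/

noncomputable section

open scoped BigOperators ComplexConjugate Matrix Matrix.Norms.L2Operator
open Filter Topology

namespace Summit.QuantumFields.BalabanUV.Beta.GAN24.ExponentialChartBaseHessianTransport

open Literature.MathematicalPhysics.QuantumFieldTheory.Balaban1983to89
open Literature.MathematicalPhysics.QuantumFieldTheory.Balaban1983to89.B5Prop11Plancherel (Tor fine)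
open Literature.MathematicalPhysics.QuantumFieldTheory.Balaban1983to89.B5G183RateUnitTower (lev)
open Literature.MathematicalPhysics.QuantumFieldTheory.Balaban1983to89.Beta (Site IsInfiniteVolumeLimit)
open Literature.MathematicalPhysics.QuantumFieldTheory.Balaban1983to89.Beta.FreeLegDictionary (cubic)
open Literature.MathematicalPhysics.QuantumFieldTheory.Balaban1983to89.Beta.BlockKernelVolumeSockets (evenPeriod)
open Summit.QuantumFields.BalabanUV.T4Continuum
open Summit.QuantumFields.BalabanUV.T4Continuum.CovariantAveragingTower (avgTow)
open Summit.QuantumFields.BalabanUV.T4Continuum.BalabanAveragedTowerUnit (idx QBlev)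
open Summit.QuantumFields.BalabanUV.T4Continuum.BalabanAveragedCoerciveTower (unitIdx)
open Summit.QuantumFields.BalabanUV.T4Continuum.KingPairingPlantedLaw (calDalev)
open Summit.QuantumFields.BalabanUV.T4Continuum.AbelianCovariantLaplacian (covPert)
open Summit.QuantumFields.BalabanUV.Beta.GAN24.ExponentialChartBaseHessianForm (hessianAt_symm hessianAt_add_left hessianAt_smul_left hessianAt_add_right hessianAt_smul_right)
open Summit.QuantumFields.BalabanUV.Beta.GAN24.ExponentialChartBaseHessianDiag (hessianAt_diag_shift)
open Summit.QuantumFields.BalabanUV.Beta.GAN24.ExponentialChartBasePolarisation (hessianAt_add_self_eq_polarisation)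

variable {d : ℕ} (L : ℕ) [NeZero L] (a : ℝ) (ha : 0 < a)

/-! ## §1 Swap, add, scale (under the invertibility at the base, every volume) -/

/-- **`isInfiniteVolumeLimit_hessianAt_swap`** — an infinite-volume limit witness `Π` for PART 269's family of `(A, B)` at `U₀` (level `k`) IS a witness for the family of `(B, A)`
(PART 270's `hessianAt_symm` volume by volume; `Tendsto.congr`). [our proof] -/
theorem isInfiniteVolumeLimit_hessianAt_swap {A₀ A B : (t : ℕ) → (k : ℕ) → Fin d → (idx L (cubic d (evenPeriod t)) k → ℝ)} (k : ℕ)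
    (h0 : ∀ t, IsUnit (calDalev L (cubic d (evenPeriod t)) a ha k + covPert L (cubic d (evenPeriod t)) (fun k'' ν' (x' : idx L (cubic d (evenPeriod t)) k'') => Complex.exp (Complex.I * ((A₀
          t) k'' ν' x' : ℂ) / ((lev L k'' : ℕ) : ℂ))) k).det)
    (hc0 : ∀ t, IsUnit (avgTow (QBlev L (cubic d (evenPeriod t))) ((L : ℝ) ^ d) (fun k' => (calDalev L (cubic d (evenPeriod t)) a ha k' + covPert L (cubic d (evenPeriod t)) (fun k'' ν' (x'
          : idx L (cubic d (evenPeriod t)) k'') => Complex.exp (Complex.I * ((A₀ t) k'' ν' x' : ℂ) / ((lev L k'' : ℕ) : ℂ))) k')⁻¹) k).det) {P : B12Beta.Kernel d}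
    (h : IsInfiniteVolumeLimit evenPeriod
      (fun t μ' ν' (z : Site d (evenPeriod t)) =>
          ((deriv (fun r : ℝ => deriv (fun s : ℝ => (avgTow (QBlev L (cubic d (evenPeriod t))) ((L : ℝ) ^ d)
          (fun k' => (calDalev L (cubic d (evenPeriod t)) a ha k' + covPert L (cubic d (evenPeriod t)) (fun k'' ν' (x' : idx L (cubic d (evenPeriod t)) k'') => Complex.exp
                (Complex.I * ((A₀ t) k'' ν' x' : ℂ) / ((lev L k'' : ℕ) : ℂ) + (Complex.I * ((A t) k'' ν' x' : ℂ) / ((lev L k'' : ℕ) : ℂ)) * ((s : ℝ) : ℂ) + (Complex.I * ((B t) k'' ν' x' :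
                      ℂ) / ((lev L k'' : ℕ) : ℂ)) * ((r : ℝ) :
                ℂ))) k')⁻¹) k)⁻¹) 0) 0)
            ((unitIdx L (cubic d (evenPeriod t))).symm (z, μ')) ((unitIdx L (cubic d (evenPeriod t))).symm (0, ν'))).re) P) :
    IsInfiniteVolumeLimit evenPeriod
      (fun t μ' ν' (z : Site d (evenPeriod t)) =>
          ((deriv (fun r : ℝ => deriv (fun s : ℝ => (avgTow (QBlev L (cubic d (evenPeriod t))) ((L : ℝ) ^ d)
          (fun k' => (calDalev L (cubic d (evenPeriod t)) a ha k' + covPert L (cubic d (evenPeriod t)) (fun k'' ν' (x' : idx L (cubic d (evenPeriod t)) k'') => Complex.exp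
                (Complex.I * ((A₀ t) k'' ν' x' : ℂ) / ((lev L k'' : ℕ) : ℂ) + (Complex.I * ((B t) k'' ν' x' : ℂ) / ((lev L k'' : ℕ) : ℂ)) * ((s : ℝ) : ℂ) + (Complex.I * ((A t) k'' ν' x' :
                      ℂ) / ((lev L k'' : ℕ) : ℂ)) * ((r : ℝ) :
                ℂ))) k')⁻¹) k)⁻¹) 0) 0)
            ((unitIdx L (cubic d (evenPeriod t))).symm (z, μ')) ((unitIdx L (cubic d (evenPeriod t))).symm (0, ν'))).re) P := by
  intro μ ν x
  refine (h μ ν x).congr fun t => ?_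
  dsimp only
  rw [hessianAt_symm L (cubic d (evenPeriod t)) a ha (A₀ t) (A t) (B t) k (h0 t) (hc0 t)]

/-- **`isInfiniteVolumeLimit_hessianAt_add_left`** — witnesses `Π₁` for `(A₁, B)` and `Π₂` for `(A₂, B)` give the witness `Π₁ + Π₂` for `(A₁ + A₂, B)` (PART 270's `hessianAt_add_left`;
`Tendsto.add`). [our proof] -/
theorem isInfiniteVolumeLimit_hessianAt_add_left {A₀ A₁ A₂ B : (t : ℕ) → (k : ℕ) → Fin d → (idx L (cubic d (evenPeriod t)) k → ℝ)} (k : ℕ)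
    (h0 : ∀ t, IsUnit (calDalev L (cubic d (evenPeriod t)) a ha k + covPert L (cubic d (evenPeriod t)) (fun k'' ν' (x' : idx L (cubic d (evenPeriod t)) k'') => Complex.exp (Complex.I * ((A₀
          t) k'' ν' x' : ℂ) / ((lev L k'' : ℕ) : ℂ))) k).det)
    (hc0 : ∀ t, IsUnit (avgTow (QBlev L (cubic d (evenPeriod t))) ((L : ℝ) ^ d) (fun k' => (calDalev L (cubic d (evenPeriod t)) a ha k' + covPert L (cubic d (evenPeriod t)) (fun k'' ν' (x'
          : idx L (cubic d (evenPeriod t)) k'') => Complex.exp (Complex.I * ((A₀ t) k'' ν' x' : ℂ) / ((lev L k'' : ℕ) : ℂ))) k')⁻¹) k).det) {P₁ P₂ : B12Beta.Kernel d}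
    (h₁ : IsInfiniteVolumeLimit evenPeriod
      (fun t μ' ν' (z : Site d (evenPeriod t)) =>
          ((deriv (fun r : ℝ => deriv (fun s : ℝ => (avgTow (QBlev L (cubic d (evenPeriod t))) ((L : ℝ) ^ d)
          (fun k' => (calDalev L (cubic d (evenPeriod t)) a ha k' + covPert L (cubic d (evenPeriod t)) (fun k'' ν' (x' : idx L (cubic d (evenPeriod t)) k'') => Complex.exp
                (Complex.I * ((A₀ t) k'' ν' x' : ℂ) / ((lev L k'' : ℕ) : ℂ) + (Complex.I * ((A₁ t) k'' ν' x' : ℂ) / ((lev L k'' : ℕ) : ℂ)) * ((s : ℝ) : ℂ) + (Complex.I * ((B t) k'' ν' x' :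
                      ℂ) / ((lev L k'' : ℕ) : ℂ)) * ((r : ℝ) :
                ℂ))) k')⁻¹) k)⁻¹) 0) 0)
            ((unitIdx L (cubic d (evenPeriod t))).symm (z, μ')) ((unitIdx L (cubic d (evenPeriod t))).symm (0, ν'))).re) P₁)
    (h₂ : IsInfiniteVolumeLimit evenPeriod
      (fun t μ' ν' (z : Site d (evenPeriod t)) =>
          ((deriv (fun r : ℝ => deriv (fun s : ℝ => (avgTow (QBlev L (cubic d (evenPeriod t))) ((L : ℝ) ^ d)
          (fun k' => (calDalev L (cubic d (evenPeriod t)) a ha k' + covPert L (cubic d (evenPeriod t)) (fun k'' ν' (x' : idx L (cubic d (evenPeriod t)) k'') => Complex.exp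
                (Complex.I * ((A₀ t) k'' ν' x' : ℂ) / ((lev L k'' : ℕ) : ℂ) + (Complex.I * ((A₂ t) k'' ν' x' : ℂ) / ((lev L k'' : ℕ) : ℂ)) * ((s : ℝ) : ℂ) + (Complex.I * ((B t) k'' ν' x' :
                      ℂ) / ((lev L k'' : ℕ) : ℂ)) * ((r : ℝ) :
                ℂ))) k')⁻¹) k)⁻¹) 0) 0)
            ((unitIdx L (cubic d (evenPeriod t))).symm (z, μ')) ((unitIdx L (cubic d (evenPeriod t))).symm (0, ν'))).re) P₂) :
    IsInfiniteVolumeLimit evenPeriod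
      (fun t μ' ν' (z : Site d (evenPeriod t)) =>
          ((deriv (fun r : ℝ => deriv (fun s : ℝ => (avgTow (QBlev L (cubic d (evenPeriod t))) ((L : ℝ) ^ d)
          (fun k' => (calDalev L (cubic d (evenPeriod t)) a ha k' + covPert L (cubic d (evenPeriod t)) (fun k'' ν' (x' : idx L (cubic d (evenPeriod t)) k'') => Complex.exp
                (Complex.I * ((A₀ t) k'' ν' x' : ℂ) / ((lev L k'' : ℕ) : ℂ) + (Complex.I * ((A₁ t k'' ν' x' + A₂ t k'' ν' x' : ℝ) : ℂ) / ((lev L k'' : ℕ) : ℂ)) * ((s : ℝ) : ℂ) + (Complex.I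
                      * ((B t) k'' ν' x' : ℂ) / ((lev L k'' : ℕ) : ℂ)) * ((r : ℝ) :
                ℂ))) k')⁻¹) k)⁻¹) 0) 0)
            ((unitIdx L (cubic d (evenPeriod t))).symm (z, μ')) ((unitIdx L (cubic d (evenPeriod t))).symm (0, ν'))).re) (P₁ + P₂) := by
  intro μ ν x
  refine ((h₁ μ ν x).add (h₂ μ ν x)).congr fun t => ?_
  dsimp only
  rw [hessianAt_add_left L (cubic d (evenPeriod t)) a ha (A₀ t) (A₁ t) (A₂ t) (B t) k (h0 t) (hc0 t), Matrix.add_apply, Complex.add_re]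

/-- **`isInfiniteVolumeLimit_hessianAt_smul_left`** — a witness `Π` for `(A, B)` gives the witness `c • Π` for `(cA, B)`, real `c` (PART 270's `hessianAt_smul_left`; `Tendsto.const_mul`).
[our proof] -/
theorem isInfiniteVolumeLimit_hessianAt_smul_left (c : ℝ) {A₀ A B : (t : ℕ) → (k : ℕ) → Fin d → (idx L (cubic d (evenPeriod t)) k → ℝ)} (k : ℕ)
    (h0 : ∀ t, IsUnit (calDalev L (cubic d (evenPeriod t)) a ha k + covPert L (cubic d (evenPeriod t)) (fun k'' ν' (x' : idx L (cubic d (evenPeriod t)) k'') => Complex.exp (Complex.I * ((A₀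
          t) k'' ν' x' : ℂ) / ((lev L k'' : ℕ) : ℂ))) k).det)
    (hc0 : ∀ t, IsUnit (avgTow (QBlev L (cubic d (evenPeriod t))) ((L : ℝ) ^ d) (fun k' => (calDalev L (cubic d (evenPeriod t)) a ha k' + covPert L (cubic d (evenPeriod t)) (fun k'' ν' (x'
          : idx L (cubic d (evenPeriod t)) k'') => Complex.exp (Complex.I * ((A₀ t) k'' ν' x' : ℂ) / ((lev L k'' : ℕ) : ℂ))) k')⁻¹) k).det) {P : B12Beta.Kernel d}
    (h : IsInfiniteVolumeLimit evenPeriod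
      (fun t μ' ν' (z : Site d (evenPeriod t)) =>
          ((deriv (fun r : ℝ => deriv (fun s : ℝ => (avgTow (QBlev L (cubic d (evenPeriod t))) ((L : ℝ) ^ d)
          (fun k' => (calDalev L (cubic d (evenPeriod t)) a ha k' + covPert L (cubic d (evenPeriod t)) (fun k'' ν' (x' : idx L (cubic d (evenPeriod t)) k'') => Complex.exp
                (Complex.I * ((A₀ t) k'' ν' x' : ℂ) / ((lev L k'' : ℕ) : ℂ) + (Complex.I * ((A t) k'' ν' x' : ℂ) / ((lev L k'' : ℕ) : ℂ)) * ((s : ℝ) : ℂ) + (Complex.I * ((B t) k'' ν' x' :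
                      ℂ) / ((lev L k'' : ℕ) : ℂ)) * ((r : ℝ) :
                ℂ))) k')⁻¹) k)⁻¹) 0) 0)
            ((unitIdx L (cubic d (evenPeriod t))).symm (z, μ')) ((unitIdx L (cubic d (evenPeriod t))).symm (0, ν'))).re) P) :
    IsInfiniteVolumeLimit evenPeriod
      (fun t μ' ν' (z : Site d (evenPeriod t)) =>
          ((deriv (fun r : ℝ => deriv (fun s : ℝ => (avgTow (QBlev L (cubic d (evenPeriod t))) ((L : ℝ) ^ d)
          (fun k' => (calDalev L (cubic d (evenPeriod t)) a ha k' + covPert L (cubic d (evenPeriod t)) (fun k'' ν' (x' : idx L (cubic d (evenPeriod t)) k'') => Complex.exp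
                (Complex.I * ((A₀ t) k'' ν' x' : ℂ) / ((lev L k'' : ℕ) : ℂ) + (Complex.I * ((c * A t k'' ν' x' : ℝ) : ℂ) / ((lev L k'' : ℕ) : ℂ)) * ((s : ℝ) : ℂ) + (Complex.I * ((B t) k''
                      ν' x' : ℂ) / ((lev L k'' : ℕ) : ℂ)) * ((r : ℝ) :
                ℂ))) k')⁻¹) k)⁻¹) 0) 0)
            ((unitIdx L (cubic d (evenPeriod t))).symm (z, μ')) ((unitIdx L (cubic d (evenPeriod t))).symm (0, ν'))).re) (c • P) := by
  intro μ ν x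
  show Tendsto _ atTop (𝓝 (c * P μ ν x))
  refine ((h μ ν x).const_mul c).congr fun t => ?_
  dsimp only
  rw [hessianAt_smul_left L (cubic d (evenPeriod t)) a ha c (A₀ t) (A t) (B t) k (h0 t) (hc0 t), Matrix.smul_apply, smul_eq_mul, Complex.re_ofReal_mul]

/-- `isInfiniteVolumeLimit_hessianAt_add_right` — witnesses for `(A, B₁)`, `(A, B₂)` give `Π₁ + Π₂` for `(A, B₁ + B₂)` (PART 270 v2's `hessianAt_add_right`). [our proof] -/
theorem isInfiniteVolumeLimit_hessianAt_add_right {A₀ A B₁ B₂ : (t : ℕ) → (k : ℕ) → Fin d → (idx L (cubic d (evenPeriod t)) k → ℝ)} (k : ℕ)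
    (h0 : ∀ t, IsUnit (calDalev L (cubic d (evenPeriod t)) a ha k + covPert L (cubic d (evenPeriod t)) (fun k'' ν' (x' : idx L (cubic d (evenPeriod t)) k'') => Complex.exp (Complex.I * ((A₀
          t) k'' ν' x' : ℂ) / ((lev L k'' : ℕ) : ℂ))) k).det)
    (hc0 : ∀ t, IsUnit (avgTow (QBlev L (cubic d (evenPeriod t))) ((L : ℝ) ^ d) (fun k' => (calDalev L (cubic d (evenPeriod t)) a ha k' + covPert L (cubic d (evenPeriod t)) (fun k'' ν' (x'
          : idx L (cubic d (evenPeriod t)) k'') => Complex.exp (Complex.I * ((A₀ t) k'' ν' x' : ℂ) / ((lev L k'' : ℕ) : ℂ))) k')⁻¹) k).det) {P₁ P₂ : B12Beta.Kernel d}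
    (h₁ : IsInfiniteVolumeLimit evenPeriod
      (fun t μ' ν' (z : Site d (evenPeriod t)) =>
          ((deriv (fun r : ℝ => deriv (fun s : ℝ => (avgTow (QBlev L (cubic d (evenPeriod t))) ((L : ℝ) ^ d)
          (fun k' => (calDalev L (cubic d (evenPeriod t)) a ha k' + covPert L (cubic d (evenPeriod t)) (fun k'' ν' (x' : idx L (cubic d (evenPeriod t)) k'') => Complex.exp
                (Complex.I * ((A₀ t) k'' ν' x' : ℂ) / ((lev L k'' : ℕ) : ℂ) + (Complex.I * ((A t) k'' ν' x' : ℂ) / ((lev L k'' : ℕ) : ℂ)) * ((s : ℝ) : ℂ) + (Complex.I * ((B₁ t) k'' ν' x' :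
                      ℂ) / ((lev L k'' : ℕ) : ℂ)) * ((r : ℝ) :
                ℂ))) k')⁻¹) k)⁻¹) 0) 0)
            ((unitIdx L (cubic d (evenPeriod t))).symm (z, μ')) ((unitIdx L (cubic d (evenPeriod t))).symm (0, ν'))).re) P₁)
    (h₂ : IsInfiniteVolumeLimit evenPeriod
      (fun t μ' ν' (z : Site d (evenPeriod t)) =>
          ((deriv (fun r : ℝ => deriv (fun s : ℝ => (avgTow (QBlev L (cubic d (evenPeriod t))) ((L : ℝ) ^ d)
          (fun k' => (calDalev L (cubic d (evenPeriod t)) a ha k' + covPert L (cubic d (evenPeriod t)) (fun k'' ν' (x' : idx L (cubic d (evenPeriod t)) k'') => Complex.exp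
                (Complex.I * ((A₀ t) k'' ν' x' : ℂ) / ((lev L k'' : ℕ) : ℂ) + (Complex.I * ((A t) k'' ν' x' : ℂ) / ((lev L k'' : ℕ) : ℂ)) * ((s : ℝ) : ℂ) + (Complex.I * ((B₂ t) k'' ν' x' :
                      ℂ) / ((lev L k'' : ℕ) : ℂ)) * ((r : ℝ) :
                ℂ))) k')⁻¹) k)⁻¹) 0) 0)
            ((unitIdx L (cubic d (evenPeriod t))).symm (z, μ')) ((unitIdx L (cubic d (evenPeriod t))).symm (0, ν'))).re) P₂) :
    IsInfiniteVolumeLimit evenPeriod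
      (fun t μ' ν' (z : Site d (evenPeriod t)) =>
          ((deriv (fun r : ℝ => deriv (fun s : ℝ => (avgTow (QBlev L (cubic d (evenPeriod t))) ((L : ℝ) ^ d)
          (fun k' => (calDalev L (cubic d (evenPeriod t)) a ha k' + covPert L (cubic d (evenPeriod t)) (fun k'' ν' (x' : idx L (cubic d (evenPeriod t)) k'') => Complex.exp
                (Complex.I * ((A₀ t) k'' ν' x' : ℂ) / ((lev L k'' : ℕ) : ℂ) + (Complex.I * ((A t) k'' ν' x' : ℂ) / ((lev L k'' : ℕ) : ℂ)) * ((s : ℝ) : ℂ) + (Complex.I * ((B₁ t k'' ν' x' +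
                      B₂ t k'' ν' x' : ℝ) : ℂ) / ((lev L k'' : ℕ) : ℂ)) * ((r : ℝ) :
                ℂ))) k')⁻¹) k)⁻¹) 0) 0)
            ((unitIdx L (cubic d (evenPeriod t))).symm (z, μ')) ((unitIdx L (cubic d (evenPeriod t))).symm (0, ν'))).re) (P₁ + P₂) := by
  intro μ ν x
  refine ((h₁ μ ν x).add (h₂ μ ν x)).congr fun t => ?_
  dsimp only
  rw [hessianAt_add_right L (cubic d (evenPeriod t)) a ha (A₀ t) (A t) (B₁ t) (B₂ t) k (h0 t) (hc0 t), Matrix.add_apply, Complex.add_re]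

/-- `isInfiniteVolumeLimit_hessianAt_smul_right` — a witness for `(A, B)` gives `c • Π` for `(A, cB)`, real `c` (PART 270 v2's `hessianAt_smul_right`). [our proof] -/
theorem isInfiniteVolumeLimit_hessianAt_smul_right (c : ℝ) {A₀ A B : (t : ℕ) → (k : ℕ) → Fin d → (idx L (cubic d (evenPeriod t)) k → ℝ)} (k : ℕ)
    (h0 : ∀ t, IsUnit (calDalev L (cubic d (evenPeriod t)) a ha k + covPert L (cubic d (evenPeriod t)) (fun k'' ν' (x' : idx L (cubic d (evenPeriod t)) k'') => Complex.exp (Complex.I * ((A₀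
          t) k'' ν' x' : ℂ) / ((lev L k'' : ℕ) : ℂ))) k).det)
    (hc0 : ∀ t, IsUnit (avgTow (QBlev L (cubic d (evenPeriod t))) ((L : ℝ) ^ d) (fun k' => (calDalev L (cubic d (evenPeriod t)) a ha k' + covPert L (cubic d (evenPeriod t)) (fun k'' ν' (x'
          : idx L (cubic d (evenPeriod t)) k'') => Complex.exp (Complex.I * ((A₀ t) k'' ν' x' : ℂ) / ((lev L k'' : ℕ) : ℂ))) k')⁻¹) k).det) {P : B12Beta.Kernel d}
    (h : IsInfiniteVolumeLimit evenPeriod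
      (fun t μ' ν' (z : Site d (evenPeriod t)) =>
          ((deriv (fun r : ℝ => deriv (fun s : ℝ => (avgTow (QBlev L (cubic d (evenPeriod t))) ((L : ℝ) ^ d)
          (fun k' => (calDalev L (cubic d (evenPeriod t)) a ha k' + covPert L (cubic d (evenPeriod t)) (fun k'' ν' (x' : idx L (cubic d (evenPeriod t)) k'') => Complex.exp
                (Complex.I * ((A₀ t) k'' ν' x' : ℂ) / ((lev L k'' : ℕ) : ℂ) + (Complex.I * ((A t) k'' ν' x' : ℂ) / ((lev L k'' : ℕ) : ℂ)) * ((s : ℝ) : ℂ) + (Complex.I * ((B t) k'' ν' x' :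
                      ℂ) / ((lev L k'' : ℕ) : ℂ)) * ((r : ℝ) :
                ℂ))) k')⁻¹) k)⁻¹) 0) 0)
            ((unitIdx L (cubic d (evenPeriod t))).symm (z, μ')) ((unitIdx L (cubic d (evenPeriod t))).symm (0, ν'))).re) P) :
    IsInfiniteVolumeLimit evenPeriod
      (fun t μ' ν' (z : Site d (evenPeriod t)) =>
          ((deriv (fun r : ℝ => deriv (fun s : ℝ => (avgTow (QBlev L (cubic d (evenPeriod t))) ((L : ℝ) ^ d)
          (fun k' => (calDalev L (cubic d (evenPeriod t)) a ha k' + covPert L (cubic d (evenPeriod t)) (fun k'' ν' (x' : idx L (cubic d (evenPeriod t)) k'') => Complex.exp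
                (Complex.I * ((A₀ t) k'' ν' x' : ℂ) / ((lev L k'' : ℕ) : ℂ) + (Complex.I * ((A t) k'' ν' x' : ℂ) / ((lev L k'' : ℕ) : ℂ)) * ((s : ℝ) : ℂ) + (Complex.I * ((c * B t k'' ν' x'
                      : ℝ) : ℂ) / ((lev L k'' : ℕ) : ℂ)) * ((r : ℝ) :
                ℂ))) k')⁻¹) k)⁻¹) 0) 0)
            ((unitIdx L (cubic d (evenPeriod t))).symm (z, μ')) ((unitIdx L (cubic d (evenPeriod t))).symm (0, ν'))).re) (c • P) := by
  intro μ ν x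
  show Tendsto _ atTop (𝓝 (c * P μ ν x))
  refine ((h μ ν x).const_mul c).congr fun t => ?_
  dsimp only
  rw [hessianAt_smul_right L (cubic d (evenPeriod t)) a ha c (A₀ t) (A t) (B t) k (h0 t) (hc0 t), Matrix.smul_apply, smul_eq_mul, Complex.re_ofReal_mul]

/-! ## §2 The diagonal witness IS leaf-01's `N = 2` witness (NO hypothesis) -/

/-- **`isInfiniteVolumeLimit_hessianAt_diag_iff`** — at level `k`, `Π` is an infinite-volume limit witness for PART 269's family of `(A, A)` at `U₀` IFF it is one for leaf-01's `N = 2`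
family `∂²_s|₀[(L^{dk}Q_k(Δ_a + covPert exp(iη(A₀,t + sA_t)))⁻¹Q_kᴴ)⁻¹]` — the two families are EQUAL volume by volume (PART 274's `hessianAt_diag_shift`), NO hypothesis. [our proof] -/
theorem isInfiniteVolumeLimit_hessianAt_diag_iff {A₀ A : (t : ℕ) → (k : ℕ) → Fin d → (idx L (cubic d (evenPeriod t)) k → ℝ)} (k : ℕ) {P : B12Beta.Kernel d} :
    IsInfiniteVolumeLimit evenPeriod
      (fun t μ' ν' (z : Site d (evenPeriod t)) =>
          ((deriv (fun r : ℝ => deriv (fun s : ℝ => (avgTow (QBlev L (cubic d (evenPeriod t))) ((L : ℝ) ^ d)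
          (fun k' => (calDalev L (cubic d (evenPeriod t)) a ha k' + covPert L (cubic d (evenPeriod t)) (fun k'' ν' (x' : idx L (cubic d (evenPeriod t)) k'') => Complex.exp
                (Complex.I * ((A₀ t) k'' ν' x' : ℂ) / ((lev L k'' : ℕ) : ℂ) + (Complex.I * ((A t) k'' ν' x' : ℂ) / ((lev L k'' : ℕ) : ℂ)) * ((s : ℝ) : ℂ) + (Complex.I * ((A t) k'' ν' x' :
                      ℂ) / ((lev L k'' : ℕ) : ℂ)) * ((r : ℝ) :
                ℂ))) k')⁻¹) k)⁻¹) 0) 0)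
            ((unitIdx L (cubic d (evenPeriod t))).symm (z, μ')) ((unitIdx L (cubic d (evenPeriod t))).symm (0, ν'))).re) P
      ↔ IsInfiniteVolumeLimit evenPeriod
      (fun t μ' ν' (z : Site d (evenPeriod t)) =>
          ((iteratedDeriv 2 (fun s : ℝ => (avgTow (QBlev L (cubic d (evenPeriod t))) ((L : ℝ) ^ d)
          (fun k' => (calDalev L (cubic d (evenPeriod t)) a ha k' + covPert L (cubic d (evenPeriod t)) (fun k'' ν' (x' : idx L (cubic d (evenPeriod t)) k'') => Complex.exp
                (Complex.I * ((A₀ t) k'' ν' x' : ℂ) / ((lev L k'' : ℕ) : ℂ) + (Complex.I * ((A t) k'' ν' x' : ℂ) / ((lev L k'' : ℕ) : ℂ)) * ((s : ℝ) : ℂ))) k')⁻¹) k)⁻¹) 0)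
            ((unitIdx L (cubic d (evenPeriod t))).symm (z, μ')) ((unitIdx L (cubic d (evenPeriod t))).symm (0, ν'))).re) P := by
  constructor <;> intro h μ ν x <;> refine (h μ ν x).congr fun t => ?_ <;> dsimp only <;>
    rw [hessianAt_diag_shift L (cubic d (evenPeriod t)) a ha (A₀ t) (A t) k]

/-! ## §3 The `N = 2` witness of `A + B` from `Π(A, B)`, `Π⁽²⁾_A`, `Π⁽²⁾_B` (PART 275 volume by volume) -/

/-- **`isInfiniteVolumeLimit_lineAt_add_of_hessianAt`** — if `Π` is a witness for the Hessian family of `(A, B)` at `U₀` and `Π⁽²⁾_A`, `Π⁽²⁾_B` are witnesses for leaf-01's `N = 2`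
families of `A` and `B` (level `k`), then `2Π + Π⁽²⁾_A + Π⁽²⁾_B` is a witness for the `N = 2` family of `A + B` (PART 275's `hessianAt_add_self_eq_polarisation` read at the entries;
`Tendsto.const_mul ∕ add`), under the invertibility at the base. [our proof] -/
theorem isInfiniteVolumeLimit_lineAt_add_of_hessianAt {A₀ A B : (t : ℕ) → (k : ℕ) → Fin d → (idx L (cubic d (evenPeriod t)) k → ℝ)} (k : ℕ)
    (h0 : ∀ t, IsUnit (calDalev L (cubic d (evenPeriod t)) a ha k + covPert L (cubic d (evenPeriod t)) (fun k'' ν' (x' : idx L (cubic d (evenPeriod t)) k'') => Complex.exp (Complex.I * ((A₀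
          t) k'' ν' x' : ℂ) / ((lev L k'' : ℕ) : ℂ))) k).det)
    (hc0 : ∀ t, IsUnit (avgTow (QBlev L (cubic d (evenPeriod t))) ((L : ℝ) ^ d) (fun k' => (calDalev L (cubic d (evenPeriod t)) a ha k' + covPert L (cubic d (evenPeriod t)) (fun k'' ν' (x'
          : idx L (cubic d (evenPeriod t)) k'') => Complex.exp (Complex.I * ((A₀ t) k'' ν' x' : ℂ) / ((lev L k'' : ℕ) : ℂ))) k')⁻¹) k).det) {P QA QB : B12Beta.Kernel d}
    (h : IsInfiniteVolumeLimit evenPeriod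
      (fun t μ' ν' (z : Site d (evenPeriod t)) =>
          ((deriv (fun r : ℝ => deriv (fun s : ℝ => (avgTow (QBlev L (cubic d (evenPeriod t))) ((L : ℝ) ^ d)
          (fun k' => (calDalev L (cubic d (evenPeriod t)) a ha k' + covPert L (cubic d (evenPeriod t)) (fun k'' ν' (x' : idx L (cubic d (evenPeriod t)) k'') => Complex.exp
                (Complex.I * ((A₀ t) k'' ν' x' : ℂ) / ((lev L k'' : ℕ) : ℂ) + (Complex.I * ((A t) k'' ν' x' : ℂ) / ((lev L k'' : ℕ) : ℂ)) * ((s : ℝ) : ℂ) + (Complex.I * ((B t) k'' ν' x' :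
                      ℂ) / ((lev L k'' : ℕ) : ℂ)) * ((r : ℝ) :
                ℂ))) k')⁻¹) k)⁻¹) 0) 0)
            ((unitIdx L (cubic d (evenPeriod t))).symm (z, μ')) ((unitIdx L (cubic d (evenPeriod t))).symm (0, ν'))).re) P)
    (hA : IsInfiniteVolumeLimit evenPeriod
      (fun t μ' ν' (z : Site d (evenPeriod t)) =>
          ((iteratedDeriv 2 (fun s : ℝ => (avgTow (QBlev L (cubic d (evenPeriod t))) ((L : ℝ) ^ d)
          (fun k' => (calDalev L (cubic d (evenPeriod t)) a ha k' + covPert L (cubic d (evenPeriod t)) (fun k'' ν' (x' : idx L (cubic d (evenPeriod t)) k'') => Complex.exp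
                (Complex.I * ((A₀ t) k'' ν' x' : ℂ) / ((lev L k'' : ℕ) : ℂ) + (Complex.I * ((A t) k'' ν' x' : ℂ) / ((lev L k'' : ℕ) : ℂ)) * ((s : ℝ) : ℂ))) k')⁻¹) k)⁻¹) 0)
            ((unitIdx L (cubic d (evenPeriod t))).symm (z, μ')) ((unitIdx L (cubic d (evenPeriod t))).symm (0, ν'))).re) QA)
    (hB : IsInfiniteVolumeLimit evenPeriod
      (fun t μ' ν' (z : Site d (evenPeriod t)) =>
          ((iteratedDeriv 2 (fun s : ℝ => (avgTow (QBlev L (cubic d (evenPeriod t))) ((L : ℝ) ^ d)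
          (fun k' => (calDalev L (cubic d (evenPeriod t)) a ha k' + covPert L (cubic d (evenPeriod t)) (fun k'' ν' (x' : idx L (cubic d (evenPeriod t)) k'') => Complex.exp
                (Complex.I * ((A₀ t) k'' ν' x' : ℂ) / ((lev L k'' : ℕ) : ℂ) + (Complex.I * ((B t) k'' ν' x' : ℂ) / ((lev L k'' : ℕ) : ℂ)) * ((s : ℝ) : ℂ))) k')⁻¹) k)⁻¹) 0)
            ((unitIdx L (cubic d (evenPeriod t))).symm (z, μ')) ((unitIdx L (cubic d (evenPeriod t))).symm (0, ν'))).re) QB) :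
    IsInfiniteVolumeLimit evenPeriod
      (fun t μ' ν' (z : Site d (evenPeriod t)) =>
          ((iteratedDeriv 2 (fun s : ℝ => (avgTow (QBlev L (cubic d (evenPeriod t))) ((L : ℝ) ^ d)
          (fun k' => (calDalev L (cubic d (evenPeriod t)) a ha k' + covPert L (cubic d (evenPeriod t)) (fun k'' ν' (x' : idx L (cubic d (evenPeriod t)) k'') => Complex.exp
                (Complex.I * ((A₀ t) k'' ν' x' : ℂ) / ((lev L k'' : ℕ) : ℂ) + (Complex.I * ((A t k'' ν' x' + B t k'' ν' x' : ℝ) : ℂ) / ((lev L k'' : ℕ) : ℂ)) * ((s : ℝ) : ℂ))) k')⁻¹) k)⁻¹)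
                      0)
            ((unitIdx L (cubic d (evenPeriod t))).symm (z, μ')) ((unitIdx L (cubic d (evenPeriod t))).symm (0, ν'))).re) (fun μ ν x => 2 * P μ ν x + QA μ ν x + QB μ ν x) := by
  have e : ∀ (t : ℕ) i j,
      2 * ((deriv (fun r : ℝ => deriv (fun s : ℝ => (avgTow (QBlev L (cubic d (evenPeriod t))) ((L : ℝ) ^ d)
          (fun k' => (calDalev L (cubic d (evenPeriod t)) a ha k' + covPert L (cubic d (evenPeriod t)) (fun k'' ν' (x' : idx L (cubic d (evenPeriod t)) k'') => Complex.exp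
                (Complex.I * ((A₀ t) k'' ν' x' : ℂ) / ((lev L k'' : ℕ) : ℂ) + (Complex.I * ((A t) k'' ν' x' : ℂ) / ((lev L k'' : ℕ) : ℂ)) * ((s : ℝ) : ℂ) + (Complex.I * ((B t) k'' ν' x' :
                      ℂ) / ((lev L k'' : ℕ) : ℂ)) * ((r : ℝ) :
                ℂ))) k')⁻¹) k)⁻¹) 0) 0) i j).re
        + ((iteratedDeriv 2 (fun s : ℝ => (avgTow (QBlev L (cubic d (evenPeriod t))) ((L : ℝ) ^ d)
          (fun k' => (calDalev L (cubic d (evenPeriod t)) a ha k' + covPert L (cubic d (evenPeriod t)) (fun k'' ν' (x' : idx L (cubic d (evenPeriod t)) k'') => Complex.exp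
                (Complex.I * ((A₀ t) k'' ν' x' : ℂ) / ((lev L k'' : ℕ) : ℂ) + (Complex.I * ((A t) k'' ν' x' : ℂ) / ((lev L k'' : ℕ) : ℂ)) * ((s : ℝ) : ℂ))) k')⁻¹) k)⁻¹) 0) i j).re
        + ((iteratedDeriv 2 (fun s : ℝ => (avgTow (QBlev L (cubic d (evenPeriod t))) ((L : ℝ) ^ d)
          (fun k' => (calDalev L (cubic d (evenPeriod t)) a ha k' + covPert L (cubic d (evenPeriod t)) (fun k'' ν' (x' : idx L (cubic d (evenPeriod t)) k'') => Complex.exp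
                (Complex.I * ((A₀ t) k'' ν' x' : ℂ) / ((lev L k'' : ℕ) : ℂ) + (Complex.I * ((B t) k'' ν' x' : ℂ) / ((lev L k'' : ℕ) : ℂ)) * ((s : ℝ) : ℂ))) k')⁻¹) k)⁻¹) 0) i j).re
      = ((iteratedDeriv 2 (fun s : ℝ => (avgTow (QBlev L (cubic d (evenPeriod t))) ((L : ℝ) ^ d)
          (fun k' => (calDalev L (cubic d (evenPeriod t)) a ha k' + covPert L (cubic d (evenPeriod t)) (fun k'' ν' (x' : idx L (cubic d (evenPeriod t)) k'') => Complex.exp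
                (Complex.I * ((A₀ t) k'' ν' x' : ℂ) / ((lev L k'' : ℕ) : ℂ) + (Complex.I * ((A t k'' ν' x' + B t k'' ν' x' : ℝ) : ℂ) / ((lev L k'' : ℕ) : ℂ)) * ((s : ℝ) : ℂ))) k')⁻¹) k)⁻¹)
                      0) i j).re := fun t i j => by
    have hv := congrArg (fun N => (N i j).re)
      (hessianAt_add_self_eq_polarisation L (cubic d (evenPeriod t)) a ha (A₀ t) (A t) (B t) k (h0 t) (hc0 t))
    simp only [Matrix.add_apply, Matrix.sub_apply, Complex.add_re, Complex.sub_re] at hv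
    linarith
  intro μ ν x
  refine ((((h μ ν x).const_mul 2).add (hA μ ν x)).add (hB μ ν x)).congr fun t => ?_
  dsimp only
  exact e t _ _

end Summit.QuantumFields.BalabanUV.Beta.GAN24.ExponentialChartBaseHessianTransport

end
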